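/-
rh-inputs cell (A1 = `Grosswald1967_thmB`), prover-3, 2026-08-28.  PieceA of the A1 architecture
(Descartes–Laguerre moment method) COMPOSED from the two counting stubs of
`a1/Grosswald1967Skeleton.lean` (v2) and the landed `laguerre_truncatedMoments`.  Kernel plumbing and
real arithmetic only; nothing in this file bears on the truth of RH.
-/
import Mathlib.Analysis.SpecialFunctions.Pow.Continuity
import Mathlib.Analysis.SpecialFunctions.Trigonometric.Arctan
import Literature.NumberTheory.LFunctions.PolyaSignChangesLaguerre

/-!
# PieceA from the truncation and block-counting stubs (PLAN-A1 §6)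

`PieceA` (`PolyaSignChangesMomentDefs`): admissible pole-pair data `(g, σ₁, λ, x, R', ρ, Ψ)` force
sign-chain density `≥ polePairRate λ x ρ = λ·arctan(γ/(λ−β))/(πx)` for `g`.  This file proves the
COMPOSITION

`pieceA_of_truncation_of_blocks : Truncation → Blocks → PieceA`,

where the two hypotheses are the universally closed statements of the skeleton's `stub_truncation`
(v2, with the binder `1 ≤ y`: on the good indices `k ≥ k₀`, `|cos((m+k)φ+α)| ≥ ½`, the truncated
moment `∫_{(1,y]} g (log t)^k t^{-(λ+1)}`, `log y ≥ xk/λ`, has the sign of `cos((m+k)φ+α)`) and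
`stub_blocks` (a real sequence with those signs for `k₀ ≤ k ≤ K` has an alternating index chain of
length `≥ φK/π − φk₀/π − 3` below `K`), so that prover-1's `pieceA` is the one-liner
`pieceA_of_truncation_of_blocks stub_truncation stub_blocks`.  The third input, Laguerre's rule of
signs `laguerre_truncatedMoments` (`PolyaSignChangesLaguerre`), is already a theorem and is used
directly.

## Proof (PLAN-A1 §6, liminf strength delivered in the typed limsup form)

Fix admissible data, `φ := arctan(γ/(λ−β)) ∈ (0, π/2)` (`γ > 0`, `β < λ`), `D := λφ/(πx)`, `c < D`,
`y₀`.  Take `y ≥ max(y₀, 2)` with `log y ≥ C₀/(D − c) + 1`, `C₀ := φ/π + φk₀/π + 3`, and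
`K := ⌊λ log y / x⌋₊` (so `xk/λ ≤ log y` for `k ≤ K`).  If some chain of `g` in `(1, y]` has length
`≥ c log y` we are done.  Otherwise every chain has length `≤ N := ⌊c log y⌋₊` (and `c log y > 0`
by the empty chain), so by `laguerre_truncatedMoments` the truncated moment sequence has `≤ N` sign
changes up to `K`; but Truncation + Blocks give an index chain of length
`n ≥ φK/π − φk₀/π − 3 ≥ D log y − C₀`, whence `(D − c) log y ≤ C₀` — contradicting the choice of `y`.
(Integrability of `g t^{-(λ+1)}` on `(1, y]` comes from the `σ₁`-clause of admissibility, `σ₁ < λ`.)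
-/

noncomputable section

open Set MeasureTheory

namespace Literature.NumberTheory.LFunctions

namespace PolyaSignChanges

/-- On a bounded interval `(1, y]`, integrability of `g t^{-(σ₁+1)}` on `(1, ∞)` gives integrability of
`g t^{-(λ+1)}` for every real `λ` (the factor `t^{-(λ−σ₁)}` is continuous on `[1, y]`).  Private twin
of `PolyaSignChangesTruncation.integrableOn_Ioc_rpow` (prover-1), kept here so that this file does not
depend on the truncation module. [folklore] -/
private theorem integrableOn_Ioc_rpow_of_integrableOn_Ioi {g : ℝ → ℝ} {σ₁ : ℝ} (lam y : ℝ)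
    (hint : IntegrableOn (fun t : ℝ => g t * t ^ (-(σ₁ + 1))) (Ioi 1)) :
    IntegrableOn (fun t : ℝ => g t * t ^ (-(lam + 1))) (Ioc 1 y) := by
  have h1 : IntegrableOn (fun t : ℝ => (g t * t ^ (-(σ₁ + 1))) * t ^ (-(lam - σ₁))) (Ioc 1 y) := by
    refine (hint.mono_set Ioc_subset_Ioi_self).mul_continuousOn_of_subset ?_ measurableSet_Ioc
      isCompact_Icc Ioc_subset_Icc_self
    exact continuousOn_id.rpow_const fun t ht => Or.inl (lt_of_lt_of_le one_pos ht.1).ne'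
  refine h1.congr_fun (fun t ht => ?_) measurableSet_Ioc
  have ht0 : 0 < t := lt_trans one_pos ht.1
  simp only
  rw [mul_assoc, ← Real.rpow_add ht0]
  congr 2
  ring

/-- **PieceA from the two counting stubs** (PLAN-A1 §6).  If (Truncation) under admissible data the
truncated moments `∫_{(1,y]} g (log t)^k t^{-(λ+1)}`, `log y ≥ xk/λ`, `y ≥ 1`, have the sign of
`cos((m+k)φ+α)` on the good indices `k ≥ k₀`, and (Blocks) such a sign pattern on `k₀ ≤ k ≤ K` yields
an alternating index chain of length `≥ φK/π − φk₀/π − 3`, then `PieceA` holds: admissible data force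
sign-chain density `≥ λφ/(πx)`.  Uses `laguerre_truncatedMoments`.  Delivered for prover-1's one-liner
`pieceA := pieceA_of_truncation_of_blocks stub_truncation stub_blocks`.
[cite: Grosswald1967, §4 Theorem B (Pólya), pp. 4–5 (the counting half of the moment-method proof)] -/
theorem pieceA_of_truncation_of_blocks
    (htrunc : ∀ (g : ℝ → ℝ) (σ₁ lam x R' : ℝ) (ρ : ℂ) (Ψ : ℂ → ℂ),
      AdmissiblePolePair g σ₁ lam x R' ρ Ψ →
      ∃ (m : ℕ) (α : ℝ) (k₀ : ℕ), 1 ≤ m ∧ ∀ (k : ℕ) (y : ℝ), k₀ ≤ k → 1 ≤ y →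
        x * k / lam ≤ Real.log y →
        1 / 2 ≤ |Real.cos ((m + k : ℝ) * Real.arctan (ρ.im / (lam - ρ.re)) + α)| →
        0 < Real.cos ((m + k : ℝ) * Real.arctan (ρ.im / (lam - ρ.re)) + α) *
          ∫ t in Ioc 1 y, g t * Real.log t ^ k * t ^ (-(lam + 1)))
    (hblocks : ∀ (a : ℕ → ℝ) (m k₀ K : ℕ) (φ α : ℝ), 0 < φ → φ < Real.pi / 2 →
      (∀ k : ℕ, k₀ ≤ k → k ≤ K → 1 / 2 ≤ |Real.cos ((m + k : ℝ) * φ + α)| →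
        0 < Real.cos ((m + k : ℝ) * φ + α) * a k) →
      ∃ (n : ℕ) (κ : Fin (n + 1) → ℕ), StrictMono κ ∧ (∀ i, κ i ≤ K) ∧
        (∀ i : Fin n, a (κ i.castSucc) * a (κ i.succ) < 0) ∧
        φ * K / Real.pi - φ * k₀ / Real.pi - 3 ≤ n) :
    PieceA := by
  intro g σ₁ lam x R' ρ Ψ hadm c hc y₀
  obtain ⟨m, α, k₀, -, htr⟩ := htrunc g σ₁ lam x R' ρ Ψ hadm
  obtain ⟨hint, hσ, hlam, hγ, hβ, -, hx1, -⟩ := hadm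
  -- the angle and the rate
  set φ : ℝ := Real.arctan (ρ.im / (lam - ρ.re)) with hφdef
  have hφpos : 0 < φ := Real.arctan_pos.2 (div_pos hγ (sub_pos.2 hβ))
  have hφlt : φ < Real.pi / 2 := Real.arctan_lt_pi_div_two _
  have hπ : 0 < Real.pi := Real.pi_pos
  have hx0 : 0 < x := lt_trans one_pos hx1
  set D : ℝ := polePairRate lam x ρ with hDdef
  have hD : D = lam * φ / (Real.pi * x) := by rw [hDdef, hφdef]; rfl
  have hDc : 0 < D - c := sub_pos.2 hc
  -- the deficit constant and the height `y`
  set C₀ : ℝ := φ / Real.pi + φ * k₀ / Real.pi + 3 with hC₀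
  set y : ℝ := max y₀ (max 2 (Real.exp (C₀ / (D - c) + 1))) with hydef
  have hy0 : y₀ ≤ y := le_max_left _ _
  have hy2 : (2 : ℝ) ≤ y := le_trans (le_max_left _ _) (le_max_right _ _)
  have hy1 : (1 : ℝ) ≤ y := le_trans one_le_two hy2
  have hy1' : (1 : ℝ) < y := lt_of_lt_of_le one_lt_two hy2
  have hypos : 0 < y := lt_trans one_pos hy1'
  have hU : C₀ / (D - c) + 1 ≤ Real.log y := by
    have h := Real.log_le_log (Real.exp_pos _)
      (le_trans (le_max_right _ _) (le_max_right _ _) : Real.exp (C₀ / (D - c) + 1) ≤ y)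
    rwa [Real.log_exp] at h
  have hUnn : 0 ≤ Real.log y := Real.log_nonneg hy1
  refine ⟨y, hy0, ?_⟩
  by_contra hno
  push Not at hno
  -- `hno : ∀ n, HasSignChain g y n → n < c * log y`
  have hcpos : 0 < c * Real.log y := by
    have := hno 0 (hasSignChain_zero hy1')
    exact_mod_cast this
  -- chain bound `N := ⌊c log y⌋₊` for `g` on `(1, y]`
  set N : ℕ := ⌊c * Real.log y⌋₊ with hNdef
  have hchain : ∀ (n : ℕ) (z : Fin (n + 1) → ℝ), StrictMono z → (∀ i, z i ∈ Ioc 1 y) →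
      (∀ i : Fin n, g (z i.castSucc) * g (z i.succ) < 0) → n ≤ N := by
    intro n z hz hzm hzs
    have hlt := hno n ⟨z, hz, hzm, hzs⟩
    exact Nat.le_floor hlt.le
  -- the truncation level `K := ⌊λ log y / x⌋₊`
  set K : ℕ := ⌊lam * Real.log y / x⌋₊ with hKdef
  have hKle : (K : ℝ) ≤ lam * Real.log y / x :=
    Nat.floor_le (div_nonneg (mul_nonneg hlam.le hUnn) hx0.le)
  have hKgt : lam * Real.log y / x - 1 < K := Nat.sub_one_lt_floor _
  -- Laguerre: the truncated moment sequence has at most `N` sign changes up to `K`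
  have hlag := laguerre_truncatedMoments g lam y K N hy1
    (integrableOn_Ioc_rpow_of_integrableOn_Ioi lam y hint) hchain
  -- Truncation + Blocks: an alternating index chain of length ≥ φK/π − φk₀/π − 3
  have hsign : ∀ k : ℕ, k₀ ≤ k → k ≤ K → 1 / 2 ≤ |Real.cos ((m + k : ℝ) * φ + α)| →
      0 < Real.cos ((m + k : ℝ) * φ + α) *
        ∫ t in Ioc 1 y, g t * Real.log t ^ k * t ^ (-(lam + 1)) := by
    intro k hk0 hkK hcos
    refine htr k y hk0 hy1 ?_ hcos
    have hk : (k : ℝ) ≤ lam * Real.log y / x := le_trans (by exact_mod_cast hkK) hKle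
    calc x * k / lam ≤ x * (lam * Real.log y / x) / lam := by gcongr
      _ = Real.log y := by field_simp
  obtain ⟨n, κ, hκ, hκK, hκs, hn⟩ :=
    hblocks (fun k => ∫ t in Ioc 1 y, g t * Real.log t ^ k * t ^ (-(lam + 1))) m k₀ K φ α
      hφpos hφlt hsign
  have hnN : n ≤ N := hlag n κ hκ hκK hκs
  -- the arithmetic: `D log y − C₀ ≤ n ≤ N ≤ c log y` versus `log y ≥ C₀/(D−c) + 1`
  have hnR : (n : ℝ) ≤ c * Real.log y :=
    le_trans (by exact_mod_cast hnN) (Nat.floor_le hcpos.le)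
  have hφπ : 0 < φ / Real.pi := div_pos hφpos hπ
  have h1 : φ / Real.pi * (lam * Real.log y / x - 1) ≤ φ / Real.pi * K :=
    mul_le_mul_of_nonneg_left hKgt.le hφπ.le
  have h2 : D * Real.log y - C₀ ≤ n := by
    have e1 : φ / Real.pi * (lam * Real.log y / x - 1) = D * Real.log y - φ / Real.pi := by
      rw [hD]; field_simp
    have e2 : φ / Real.pi * K = φ * K / Real.pi := by ring
    rw [e1] at h1
    rw [e2] at h1
    have e3 : C₀ = φ / Real.pi + φ * k₀ / Real.pi + 3 := hC₀
    linarith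
  have h3 : C₀ + (D - c) ≤ (D - c) * Real.log y := by
    have := mul_le_mul_of_nonneg_left hU hDc.le
    rwa [mul_add, mul_div_cancel₀ _ hDc.ne', mul_one] at this
  nlinarith

end PolyaSignChanges

end Literature.NumberTheory.LFunctions

end
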